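import Literature.Probability.RandomPlanarGeometry.SLEKappaRhoLogGammaJets
import Literature.Probability.RandomPlanarGeometry.SLEKappaRhoDriftIdentity
import HarnessLib

/-!
# [LSW] Lemma 8.9: the time derivative `λ` of `log M` along the hull evolution, and the perturbation of the three logarithms

Sequel to `SLEKappaRhoLogGamma` (`ell E ρ x y = (5/8) log E'(x) + b log E'(y) + c log DQ E x y`),
after

* G. F. Lawler, O. Schramm, W. Werner, *Conformal restriction: the chordal case*, J. Amer. Math.
  Soc. **16** (2003) 917–955 (**[LSW]**), §5 (5.1)
  (`∂_t h_t(z) = 2h_t'(W_t)²/(h_t(z) − h_t(W_t)) − 2h_t'(z)/(z − W_t)`) and §8.4, proof of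
  Lemma 8.9 (the `dt`-terms of `d[h(W)], d[h'(W)], d[h(O)], d[h'(O)]`).

One step of the Loewner flow replaces the reflected map `E = E_B` of the slid hull by
`E + 2u·D + O(u(η+u))` with the drift function `D(z) = d²/E(z) − E'(z)/z` (`Loewner.driftFun` near
the tip, `LoewnerImageStepResidue`/`LoewnerImageStepFar`). Hence the three arguments of the
logarithms in `ell` move by `s₁ ≈ 2u D'(x)`, `s₂ ≈ 2u D'(y)`, `s₃ ≈ 2u DQ D x y`, and
`ell ↦ ell + u·lam + O(…)` with

  `lam E D ρ x y = (5/8)·2D'(x)/E'(x) + b·2D'(y)/E'(y) + c·2 DQ D x y / DQ E x y`.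

For a second holomorphic function `D` on the box with `|D| ≤ M` (`DriftData`) this file PROVES:

* `norm_lam_le` — `|lam| ≤ lamBound` for `x ∈ ball 0 (η/2)`, `y ∈ ball y₀ (η/2)`, `y₀` real in
  `[−R−2, η/2]` (Cauchy bound `|D'| ≤ 4M/η` on the inner box);
* `norm_lam_sub_lam_left_le`, `norm_lam_sub_lam_right_le` — `lam` is Lipschitz in each variable
  there (Cauchy again), so that `u·lam(x_h, o + a) = u·lam(0, o) + O(u(|x_h| + |a|))`;
* `lam_zero_eq_jetLam` — at `(0, o)`, `o ≠ 0`, `lam` is the rational function `jetLam` of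
  `SLEKappaRhoDriftIdentity` in the jets of `E` and the values `D(0), D'(0), D(o), D'(o)`;
* `norm_log_add_sub_log_sub_div_le` — `|log(p + s) − log p − s/p| ≤ |s|²/δ²` for `Re p ≥ δ`,
  `|s| ≤ δ/2` (the logarithm along the segment, `log(p+s) − log p = s ∫₀¹ dt/(p + ts)`), and the
  resulting three-term perturbation bound `norm_ell_args_perturb_le`.

No named facts; definitions `innerBox`, `DriftData` (hypothesis bundle), `lam`, `lamBound`.

## References

* [LSW] §5 (5.1); §8.4 proof of Lemma 8.9. [LawlerSchrammWerner2003Restriction]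
-/

noncomputable section

open Set Filter Metric Complex MeasureTheory
open scoped Topology Real

namespace Literature.Probability.RandomPlanarGeometry

namespace SLEKappaRho

open Literature.Analysis.Complex

variable {E D : ℂ → ℂ} {δ η R M : ℝ}

/-! ### The inner box and the drift function -/

/-- The closed inner box `{−R − 5/2 ≤ Re z ≤ η, |Im z| ≤ η}`: its points have their `η/4`-balls
inside `jetBox R η` (for `η ≤ 1`). [folklore] -/
def innerBox (R η : ℝ) : Set ℂ := {z : ℂ | z.re ∈ Icc (-R - 5 / 2) η ∧ |z.im| ≤ η}

/-- `ball z (η/4) ⊆ jetBox R η` for `z` in the inner box. [folklore] -/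
theorem ball_subset_jetBox_of_mem_innerBox (hη : 0 < η) (hη1 : η ≤ 1) {z : ℂ} (hz : z ∈ innerBox R η) :
    ball z (η / 4) ⊆ jetBox R η := by
  intro w hw
  obtain ⟨⟨hz1, hz2⟩, hz3⟩ := hz
  rw [mem_ball, dist_eq_norm] at hw
  have hre : |w.re - z.re| < η / 4 := by
    have := abs_re_le_norm (w - z); simp at this; linarith
  have him : |w.im - z.im| < η / 4 := by
    have := abs_im_le_norm (w - z); simp at this; linarith
  rw [abs_lt] at hre him
  rw [abs_le] at hz3
  refine ⟨⟨by linarith, by linarith⟩, ?_⟩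
  rw [abs_lt]; constructor <;> linarith

/-- The inner box lies in the box. [folklore] -/
theorem innerBox_subset_jetBox (hη : 0 < η) (hη1 : η ≤ 1) : innerBox R η ⊆ jetBox R η := fun z hz ↦
  ball_subset_jetBox_of_mem_innerBox hη hη1 hz (mem_ball_self (by linarith))

/-- The inner box is convex (segments stay inside). [folklore] -/
theorem add_smul_sub_mem_innerBox {x y : ℂ} (hx : x ∈ innerBox R η) (hy : y ∈ innerBox R η)
    {t : ℝ} (ht : t ∈ Icc (0 : ℝ) 1) : y + (t : ℂ) * (x - y) ∈ innerBox R η := by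
  obtain ⟨⟨hx1, hx2⟩, hx3⟩ := hx
  obtain ⟨⟨hy1, hy2⟩, hy3⟩ := hy
  obtain ⟨ht0, ht1⟩ := ht
  have hre : (y + (t : ℂ) * (x - y)).re = (1 - t) * y.re + t * x.re := by simp; ring
  have him : (y + (t : ℂ) * (x - y)).im = (1 - t) * y.im + t * x.im := by simp; ring
  rw [abs_le] at hx3 hy3
  refine ⟨⟨?_, ?_⟩, ?_⟩
  · rw [hre]; nlinarith
  · rw [hre]; nlinarith
  · rw [him, abs_le]; constructor <;> nlinarith

/-- `ball 0 (η/4) ⊆ innerBox R η` (`R ≥ 0`, `η ≤ 1`). [folklore] -/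
theorem ball_zero_subset_innerBox (hR : 0 ≤ R) (hη1 : η ≤ 1) : ball (0 : ℂ) (η / 4) ⊆ innerBox R η := by
  intro z hz
  rw [mem_ball, dist_zero_right] at hz
  have hre := abs_re_le_norm z
  have him := abs_im_le_norm z
  rw [abs_le] at hre
  exact ⟨⟨by linarith, by linarith⟩, by linarith⟩

/-- `ball y₀ (η/4) ⊆ innerBox R η` for real `y₀ ∈ [−R−2, η/2]` (`η ≤ 1`). [folklore] -/
theorem ball_subset_innerBox (hη1 : η ≤ 1) {y₀ : ℝ} (hy₀ : y₀ ∈ Icc (-R - 2) (η / 2)) :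
    ball (y₀ : ℂ) (η / 4) ⊆ innerBox R η := by
  intro z hz
  rw [mem_ball, dist_eq_norm] at hz
  have hre : |z.re - y₀| < η / 4 := by
    have := abs_re_le_norm (z - y₀); simp at this; linarith
  have him : |z.im| < η / 4 := by
    have := abs_im_le_norm (z - y₀); simp at this; linarith
  rw [abs_lt] at hre
  exact ⟨⟨by linarith [hy₀.1], by linarith [hy₀.2]⟩, him.le.trans (by linarith)⟩

/-- **The drift function on the box** (a hypothesis bundle): `D` holomorphic on `jetBox R η` with
`|D| ≤ M` there — for the slid hull, the function `d²/E_B − E_B'/z` of [LSW] (5.1)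
(`Loewner.driftFun` across the removable singularity at the tip). [folklore] -/
structure DriftData (D : ℂ → ℂ) (η R M : ℝ) : Prop where
  differentiableOn : DifferentiableOn ℂ D (jetBox R η)
  norm_le : ∀ z ∈ jetBox R η, ‖D z‖ ≤ M
  M_nonneg : 0 ≤ M

namespace DriftData

/-- `D'` is holomorphic on the box. [folklore] -/
theorem differentiableOn_deriv (hD : DriftData D η R M) : DifferentiableOn ℂ (deriv D) (jetBox R η) :=
  ((hD.differentiableOn.analyticOnNhd (isOpen_jetBox R η)).deriv).differentiableOn

/-- **`|D'| ≤ 8M/η` on the inner box** (Cauchy on `ball z (η/4)`). [folklore] -/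
theorem norm_deriv_le (hD : DriftData D η R M) (hη : 0 < η) (hη1 : η ≤ 1) {z : ℂ} (hz : z ∈ innerBox R η) :
    ‖deriv D z‖ ≤ 8 * M / η := by
  have hsub := ball_subset_jetBox_of_mem_innerBox hη hη1 hz
  have h := norm_deriv_le_of_forall_mem_ball (f := D) (c := z) (by linarith : 0 < η / 4)
    (hD.differentiableOn.mono hsub) fun w hw ↦ hD.norm_le w (hsub hw)
  refine h.trans (le_of_eq ?_); field_simp; ring

/-- `D` has derivative `D'(z)` on the box. [folklore] -/
theorem hasDerivAt (hD : DriftData D η R M) {z : ℂ} (hz : z ∈ jetBox R η) : HasDerivAt D (deriv D z) z :=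
  (hD.differentiableOn.differentiableAt ((isOpen_jetBox R η).mem_nhds hz)).hasDerivAt

end DriftData

/-! ### The divided difference of `D` -/

/-- **Integral representation** of `DQ D x y` on the box. [folklore] -/
theorem DQ_eq_integral_of_differentiableOn {f : ℂ → ℂ} (hf : DifferentiableOn ℂ f (jetBox R η))
    {x y : ℂ} (hx : x ∈ jetBox R η) (hy : y ∈ jetBox R η) :
    DQ f x y = ∫ t in (0 : ℝ)..1, deriv f (y + (t : ℂ) * (x - y)) := by
  have hseg : ∀ t ∈ Icc (0 : ℝ) 1, y + (t : ℂ) * (x - y) ∈ jetBox R η := fun t ht ↦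
    add_smul_sub_mem_jetBox hx hy ht
  have hfc : ContinuousOn (deriv f) (jetBox R η) := ((hf.analyticOnNhd (isOpen_jetBox R η)).deriv).continuousOn
  have hcont : ContinuousOn (fun t : ℝ ↦ deriv f (y + t • (x - y))) (Icc 0 1) := by
    have hγ : Continuous fun t : ℝ ↦ y + (t : ℂ) * (x - y) := by fun_prop
    have := hfc.comp hγ.continuousOn (fun t ht ↦ hseg t ht)
    simpa [Function.comp_def, smul_eq_mul] using this
  have hderiv : ∀ t ∈ Icc (0 : ℝ) 1, HasDerivAt f (deriv f (y + t • (x - y))) (y + t • (x - y)) := by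
    intro t ht
    have hmem : y + (t : ℂ) * (x - y) ∈ jetBox R η := hseg t ht
    have := (hf.differentiableAt ((isOpen_jetBox R η).mem_nhds hmem)).hasDerivAt
    simpa [smul_eq_mul] using this
  have hftc := intervalIntegral.integral_unitInterval_deriv_eq_sub hcont hderiv
  simp only [smul_eq_mul, add_sub_cancel] at hftc
  rcases eq_or_ne x y with rfl | hne
  · simp [DQ_same]
  · have hxy : x - y ≠ 0 := sub_ne_zero.2 hne
    have hftc' : (x - y) * ∫ t in (0 : ℝ)..1, deriv f (y + (t : ℂ) * (x - y)) = f x - f y := by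
      simpa [Complex.real_smul] using hftc
    rw [DQ_of_ne f hne, div_eq_iff hxy, mul_comm]
    exact hftc'.symm

/-- **`|DQ D x y| ≤ 8M/η` for `x, y` in the inner box** (the segment stays in the inner box, where
`|D'| ≤ 8M/η`). [folklore] -/
theorem norm_DQ_drift_le (hD : DriftData D η R M) (hη : 0 < η) (hη1 : η ≤ 1) {x y : ℂ} (hx : x ∈ innerBox R η)
    (hy : y ∈ innerBox R η) : ‖DQ D x y‖ ≤ 8 * M / η := by
  have hxB := innerBox_subset_jetBox hη hη1 hx
  have hyB := innerBox_subset_jetBox hη hη1 hy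
  rw [DQ_eq_integral_of_differentiableOn hD.differentiableOn hxB hyB]
  have h := intervalIntegral.norm_integral_le_of_norm_le_const (a := (0 : ℝ)) (b := 1) (C := 8 * M / η)
    (f := fun t ↦ deriv D (y + (t : ℂ) * (x - y))) (fun t ht ↦ by
      rw [uIoc_of_le zero_le_one] at ht
      exact hD.norm_deriv_le hη hη1 (add_smul_sub_mem_innerBox hx hy ⟨ht.1.le, ht.2⟩))
  simpa using h

/-- `x ↦ DQ D x y` is holomorphic on the box. [folklore] -/
theorem differentiableOn_DQ_drift_left (hD : DriftData D η R M) {y : ℂ} (hy : y ∈ jetBox R η) :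
    DifferentiableOn ℂ (fun x ↦ DQ D x y) (jetBox R η) :=
  (Complex.differentiableOn_dslope ((isOpen_jetBox R η).mem_nhds hy)).2 hD.differentiableOn

/-- `y ↦ DQ D x y` is holomorphic on the box. [folklore] -/
theorem differentiableOn_DQ_drift_right (hD : DriftData D η R M) {x : ℂ} (hx : x ∈ jetBox R η) :
    DifferentiableOn ℂ (fun y ↦ DQ D x y) (jetBox R η) := by
  have : (fun y ↦ DQ D x y) = fun y ↦ DQ D y x := funext fun y ↦ DQ_comm D x y
  rw [this]; exact differentiableOn_DQ_drift_left hD hx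

/-! ### The time derivative `lam` of `ell` -/

/-- **The time derivative of `log M` along the hull evolution** `E ↦ E + 2uD`:
`lam E D ρ x y = (5/8)·2D'(x)/E'(x) + b·2D'(y)/E'(y) + c·2 DQ D x y/DQ E x y`
(the `dt`-parts of `d log h'(W)`, `d log h'(O)`, `d log[(h(W) − h(O))/(W − O)]` at FIXED `W, O`).
[cite: LawlerSchrammWerner2003Restriction, proof of Lemma 8.9 (the dt-terms) with §5 (5.1)] -/
def lam (E D : ℂ → ℂ) (ρ : ℝ) (x y : ℂ) : ℂ :=
  (5 / 8 : ℂ) * (2 * deriv D x / deriv E x) + (expB ρ : ℂ) * (2 * deriv D y / deriv E y) +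
    (expC ρ : ℂ) * (2 * DQ D x y / DQ E x y)

/-- The bound `(5/8 + |b| + |c|) · 2 · (8M/η)/δ` for `|lam|` on the inner box. [folklore] -/
def lamBound (ρ δ η M : ℝ) : ℝ := (5 / 8 + |expB ρ| + |expC ρ|) * (2 * (8 * M / η) / δ)

/-- `0 ≤ lamBound`. [folklore] -/
theorem lamBound_nonneg (ρ : ℝ) {δ η M : ℝ} (hδ : 0 < δ) (hη : 0 < η) (hM : 0 ≤ M) : 0 ≤ lamBound ρ δ η M := by
  unfold lamBound; positivity

/-- **`|lam E D ρ x y| ≤ lamBound` for `x, y` in the inner box.** [folklore] -/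
theorem norm_lam_le (hc : JetControl E δ η R) (hD : DriftData D η R M) (ρ : ℝ) {x y : ℂ}
    (hx : x ∈ innerBox R η) (hy : y ∈ innerBox R η) : ‖lam E D ρ x y‖ ≤ lamBound ρ δ η M := by
  have hη := hc.η_pos
  have hη1 := hc.η_le_one
  have hδ := hc.δ_pos
  have hxB := innerBox_subset_jetBox hη hη1 hx
  have hyB := innerBox_subset_jetBox hη hη1 hy
  have hDx := hD.norm_deriv_le hη hη1 hx
  have hDy := hD.norm_deriv_le hη hη1 hy
  have hDQ := norm_DQ_drift_le hD hη hη1 hx hy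
  have hEx : δ ≤ ‖deriv E x‖ := (hc.le_re_deriv x hxB).trans (re_le_norm _)
  have hEy : δ ≤ ‖deriv E y‖ := (hc.le_re_deriv y hyB).trans (re_le_norm _)
  have hQ : δ ≤ ‖DQ E x y‖ := (le_re_DQ_and_norm_DQ_le hc hxB hyB).1.trans (re_le_norm _)
  have hM8 : 0 ≤ 8 * M / η := by have := hD.M_nonneg; positivity
  have q1 : ‖2 * deriv D x / deriv E x‖ ≤ 2 * (8 * M / η) / δ := by
    rw [norm_div, norm_mul, Complex.norm_two]
    exact div_le_div₀ (by positivity) (by gcongr) hδ hEx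
  have q2 : ‖2 * deriv D y / deriv E y‖ ≤ 2 * (8 * M / η) / δ := by
    rw [norm_div, norm_mul, Complex.norm_two]
    exact div_le_div₀ (by positivity) (by gcongr) hδ hEy
  have q3 : ‖2 * DQ D x y / DQ E x y‖ ≤ 2 * (8 * M / η) / δ := by
    rw [norm_div, norm_mul, Complex.norm_two]
    exact div_le_div₀ (by positivity) (by gcongr) hδ hQ
  have n58 : ‖(5 / 8 : ℂ)‖ = 5 / 8 := by norm_num
  have nb : ‖(expB ρ : ℂ)‖ = |expB ρ| := by rw [Complex.norm_real, Real.norm_eq_abs]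
  have ncc : ‖(expC ρ : ℂ)‖ = |expC ρ| := by rw [Complex.norm_real, Real.norm_eq_abs]
  unfold lam lamBound
  calc _ ≤ ‖(5 / 8 : ℂ) * (2 * deriv D x / deriv E x)‖ + ‖(expB ρ : ℂ) * (2 * deriv D y / deriv E y)‖ +
        ‖(expC ρ : ℂ) * (2 * DQ D x y / DQ E x y)‖ := norm_add₃_le
    _ ≤ 5 / 8 * (2 * (8 * M / η) / δ) + |expB ρ| * (2 * (8 * M / η) / δ) + |expC ρ| * (2 * (8 * M / η) / δ) := by
        rw [norm_mul, norm_mul, norm_mul, n58, nb, ncc]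
        gcongr
    _ = _ := by ring

/-- **`x ↦ lam E D ρ x y` is holomorphic on the box.** [folklore] -/
theorem differentiableOn_lam_left (hc : JetControl E δ η R) (hD : DriftData D η R M) (ρ : ℝ) {y : ℂ}
    (hy : y ∈ jetBox R η) : DifferentiableOn ℂ (fun x ↦ lam E D ρ x y) (jetBox R η) := by
  have hE'ne : ∀ x ∈ jetBox R η, deriv E x ≠ 0 := fun x hx h ↦ by
    have := hc.le_re_deriv x hx; rw [h] at this; simp at this; linarith [hc.δ_pos]
  have hQne : ∀ x ∈ jetBox R η, DQ E x y ≠ 0 := fun x hx h ↦ by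
    have := (le_re_DQ_and_norm_DQ_le hc hx hy).1; rw [h] at this; simp at this; linarith [hc.δ_pos]
  have h1 : DifferentiableOn ℂ (fun x ↦ 2 * deriv D x / deriv E x) (jetBox R η) :=
    (hD.differentiableOn_deriv.const_mul _).div hc.differentiableOn_deriv hE'ne
  have h3 : DifferentiableOn ℂ (fun x ↦ 2 * DQ D x y / DQ E x y) (jetBox R η) :=
    ((differentiableOn_DQ_drift_left hD hy).const_mul _).div (differentiableOn_DQ_left hc hy) hQne
  unfold lam
  exact ((h1.const_mul _).add (differentiableOn_const _)).add (h3.const_mul _)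

/-- **`y ↦ lam E D ρ x y` is holomorphic on the box.** [folklore] -/
theorem differentiableOn_lam_right (hc : JetControl E δ η R) (hD : DriftData D η R M) (ρ : ℝ) {x : ℂ}
    (hx : x ∈ jetBox R η) : DifferentiableOn ℂ (fun y ↦ lam E D ρ x y) (jetBox R η) := by
  have hE'ne : ∀ y ∈ jetBox R η, deriv E y ≠ 0 := fun y hy h ↦ by
    have := hc.le_re_deriv y hy; rw [h] at this; simp at this; linarith [hc.δ_pos]
  have hQne : ∀ y ∈ jetBox R η, DQ E x y ≠ 0 := fun y hy h ↦ by
    have := (le_re_DQ_and_norm_DQ_le hc hx hy).1; rw [h] at this; simp at this; linarith [hc.δ_pos]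
  have h2 : DifferentiableOn ℂ (fun y ↦ 2 * deriv D y / deriv E y) (jetBox R η) :=
    (hD.differentiableOn_deriv.const_mul _).div hc.differentiableOn_deriv hE'ne
  have h3 : DifferentiableOn ℂ (fun y ↦ 2 * DQ D x y / DQ E x y) (jetBox R η) :=
    ((differentiableOn_DQ_drift_right hD hx).const_mul _).div (differentiableOn_DQ_right hc hx) hQne
  unfold lam
  exact (((differentiableOn_const _).add (h2.const_mul _))).add (h3.const_mul _)

/-- **`lam` is Lipschitz in `x` near `0`**: for `y₀` real in `[−R−2, η/2]`, `y ∈ ball y₀ (η/4)` and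
`x, x' ∈ ball 0 (η/8)`, `|lam(x, y) − lam(x', y)| ≤ (16 lamBound/η)|x − x'|`. [folklore] -/
theorem norm_lam_sub_lam_left_le (hc : JetControl E δ η R) (hD : DriftData D η R M) (ρ : ℝ)
    {y₀ : ℝ} (hy₀ : y₀ ∈ Icc (-R - 2) (η / 2)) {y : ℂ} (hy : y ∈ ball (y₀ : ℂ) (η / 4))
    {x x' : ℂ} (hx : x ∈ ball (0 : ℂ) (η / 8)) (hx' : x' ∈ ball (0 : ℂ) (η / 8)) :
    ‖lam E D ρ x y - lam E D ρ x' y‖ ≤ 16 * lamBound ρ δ η M / η * ‖x - x'‖ := by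
  have hη := hc.η_pos
  have hη1 := hc.η_le_one
  have hyI := ball_subset_innerBox hη1 hy₀ hy
  have hyB := innerBox_subset_jetBox hη hη1 hyI
  have hsub : ball (0 : ℂ) (η / 4) ⊆ innerBox R η := ball_zero_subset_innerBox hc.R_nonneg hη1
  have h := norm_sub_le_mul_of_forall_mem_ball (f := fun x ↦ lam E D ρ x y) (c := 0) (R := η / 4)
    (M := lamBound ρ δ η M) (by linarith)
    ((differentiableOn_lam_left hc hD ρ hyB).mono (hsub.trans (innerBox_subset_jetBox hη hη1)))
    (fun u hu ↦ norm_lam_le hc hD ρ (hsub hu) hyI)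
    (z := x) (w := x') (by simpa [show η / 4 / 2 = η / 8 by ring] using hx)
    (by simpa [show η / 4 / 2 = η / 8 by ring] using hx')
  refine h.trans (le_of_eq ?_); field_simp; ring

/-- **`lam` is Lipschitz in `y`**: for real `y₀ ∈ [−R−2, η/2]`, `x ∈ ball 0 (η/4)` and
`y, y' ∈ ball y₀ (η/8)`, `|lam(x, y) − lam(x, y')| ≤ (16 lamBound/η)|y − y'|`. [folklore] -/
theorem norm_lam_sub_lam_right_le (hc : JetControl E δ η R) (hD : DriftData D η R M) (ρ : ℝ)
    {y₀ : ℝ} (hy₀ : y₀ ∈ Icc (-R - 2) (η / 2)) {x : ℂ} (hx : x ∈ ball (0 : ℂ) (η / 4))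
    {y y' : ℂ} (hy : y ∈ ball (y₀ : ℂ) (η / 8)) (hy' : y' ∈ ball (y₀ : ℂ) (η / 8)) :
    ‖lam E D ρ x y - lam E D ρ x y'‖ ≤ 16 * lamBound ρ δ η M / η * ‖y - y'‖ := by
  have hη := hc.η_pos
  have hη1 := hc.η_le_one
  have hxI := ball_zero_subset_innerBox hc.R_nonneg hη1 hx
  have hxB := innerBox_subset_jetBox hη hη1 hxI
  have hsub : ball (y₀ : ℂ) (η / 4) ⊆ innerBox R η := ball_subset_innerBox hη1 hy₀
  have h := norm_sub_le_mul_of_forall_mem_ball (f := fun y ↦ lam E D ρ x y) (c := (y₀ : ℂ)) (R := η / 4)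
    (M := lamBound ρ δ η M) (by linarith)
    ((differentiableOn_lam_right hc hD ρ hxB).mono (hsub.trans (innerBox_subset_jetBox hη hη1)))
    (fun u hu ↦ norm_lam_le hc hD ρ hxI (hsub hu))
    (z := y) (w := y') (by simpa [show η / 4 / 2 = η / 8 by ring] using hy)
    (by simpa [show η / 4 / 2 = η / 8 by ring] using hy')
  refine h.trans (le_of_eq ?_); field_simp; ring

/-- **`lam(0, o) = jetLam …` for `o ≠ 0` in the box**, given the values of `D`:
`D(0) = −(3/2)E''(0)`, `D'(0) = E''(0)²/(4E'(0)) − (2/3)E'''(0)` (the jet of the drift function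
at the tip, `Loewner.driftFun_zero`, `Loewner.hasDerivAt_driftFun_zero`) and
`D(o) = d²/E(o) − E'(o)/o`, `D'(o) = −d²E'(o)/E(o)² − E''(o)/o + E'(o)/o²` ([LSW] (5.1) off the
tip). [cite: LawlerSchrammWerner2003Restriction, §5 (5.1) and proof of Lemma 8.9 (d[h(O)], d[h'(O)])] -/
theorem lam_zero_eq_jetLam (hc : JetControl E δ η R) (ρ : ℝ) {o : ℂ} (ho : o ∈ jetBox R η) (ho0 : o ≠ 0)
    (hD0 : D 0 = -(3 / 2 : ℂ) * deriv (deriv E) 0)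
    (hD'0 : deriv D 0 = (deriv (deriv E) 0) ^ 2 / (4 * deriv E 0) - (2 / 3 : ℂ) * deriv (deriv (deriv E)) 0)
    (hDo : D o = deriv E 0 ^ 2 / E o - deriv E o / o)
    (hD'o : deriv D o = -(deriv E 0 ^ 2 * deriv E o / E o ^ 2) - deriv (deriv E) o / o + deriv E o / o ^ 2) :
    lam E D ρ 0 o = jetLam (expB ρ : ℂ) (expC ρ : ℂ) o (E o) (deriv E o) (deriv (deriv E) o) (deriv E 0)
      (deriv (deriv E) 0) (deriv (deriv (deriv E)) 0) := by
  have hEo : E o ≠ 0 := hc.map_ne_zero ho ho0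
  have hd : deriv E 0 ≠ 0 := fun h ↦ by
    have := hc.le_re_deriv 0 hc.zero_mem; rw [h] at this; simp at this; linarith [hc.δ_pos]
  have hDQE : DQ E 0 o = E o / o := by rw [DQ_of_ne E ho0.symm, hc.map_zero]; field_simp; ring
  have hDQD : DQ D 0 o = (D 0 - D o) / (0 - o) := DQ_of_ne D ho0.symm
  rw [lam, jetLam, hDQE, hDQD, hD0, hD'0, hDo, hD'o]
  field_simp
  ring

/-! ### Perturbing the arguments of the logarithms -/

/-- **`|log(p + s) − log p − s/p| ≤ 2|s|²/δ²`** for `0 < δ ≤ Re p` and `|s| ≤ δ/2`: along the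
segment `p + ts` (which stays in `Re ≥ δ/2`), `log(p + s) − log p = s ∫₀¹ dt/(p + ts)` and
`|1/(p + ts) − 1/p| = t|s|/(|p||p + ts|) ≤ 2|s|/δ²`. [folklore] -/
theorem norm_log_add_sub_log_sub_div_le {δ : ℝ} (hδ : 0 < δ) {p s : ℂ} (hp : δ ≤ p.re) (hs : ‖s‖ ≤ δ / 2) :
    ‖Complex.log (p + s) - Complex.log p - s / p‖ ≤ 2 * ‖s‖ ^ 2 / δ ^ 2 := by
  -- the segment stays in `Re ≥ δ/2`
  have hseg : ∀ t ∈ Icc (0 : ℝ) 1, δ / 2 ≤ (p + (t : ℂ) * s).re := by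
    intro t ht
    have h1 : |((t : ℂ) * s).re| ≤ ‖(t : ℂ) * s‖ := abs_re_le_norm _
    rw [norm_mul, Complex.norm_real, Real.norm_eq_abs, abs_of_nonneg ht.1] at h1
    have h2 : t * ‖s‖ ≤ δ / 2 := by nlinarith [ht.2, norm_nonneg s]
    rw [add_re]
    have := neg_abs_le ((t : ℂ) * s).re
    linarith
  have hslit : ∀ t ∈ Icc (0 : ℝ) 1, p + (t : ℂ) * s ∈ slitPlane := fun t ht ↦
    mem_slitPlane_iff.2 (Or.inl (by linarith [hseg t ht]))
  have hne : ∀ t ∈ Icc (0 : ℝ) 1, p + (t : ℂ) * s ≠ 0 := fun t ht h ↦ by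
    have := hseg t ht; rw [h] at this; simp at this; linarith
  have hnorm : ∀ t ∈ Icc (0 : ℝ) 1, δ / 2 ≤ ‖p + (t : ℂ) * s‖ := fun t ht ↦ (hseg t ht).trans (re_le_norm _)
  have hp0 : δ ≤ ‖p‖ := hp.trans (re_le_norm _)
  have hpne : p ≠ 0 := fun h ↦ by rw [h, norm_zero] at hp0; linarith
  -- FTC for `log` along the segment
  have hcont' : ContinuousOn (fun t : ℝ ↦ (p + (t : ℂ) * s)⁻¹) (Icc 0 1) :=
    ContinuousOn.inv₀ (by fun_prop) fun t ht ↦ hne t ht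
  have hcont : ContinuousOn (fun t : ℝ ↦ (p + t • s)⁻¹) (Icc 0 1) := by
    simpa [Complex.real_smul] using hcont'
  have hderiv : ∀ t ∈ Icc (0 : ℝ) 1, HasDerivAt Complex.log (p + t • s)⁻¹ (p + t • s) := fun t ht ↦ by
    simpa [Complex.real_smul] using (Complex.hasStrictDerivAt_log (hslit t ht)).hasDerivAt
  have hftc := intervalIntegral.integral_unitInterval_deriv_eq_sub hcont hderiv
  have hftc' : s * ∫ t in (0 : ℝ)..1, (p + (t : ℂ) * s)⁻¹ = Complex.log (p + s) - Complex.log p := by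
    simpa [Complex.real_smul, smul_eq_mul] using hftc
  have hint1 : IntervalIntegrable (fun t : ℝ ↦ (p + (t : ℂ) * s)⁻¹) volume 0 1 :=
    hcont'.intervalIntegrable_of_Icc zero_le_one
  have hrepr : Complex.log (p + s) - Complex.log p - s / p =
      s * ∫ t in (0 : ℝ)..1, ((p + (t : ℂ) * s)⁻¹ - p⁻¹) := by
    rw [intervalIntegral.integral_sub hint1 intervalIntegrable_const, intervalIntegral.integral_const]
    simp only [sub_zero, one_smul]
    rw [mul_sub, hftc', div_eq_mul_inv]
  rw [hrepr, norm_mul]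
  -- bound the integrand by `2|s|/δ²` and integrate
  have hbd : ∀ t ∈ Set.uIoc (0 : ℝ) 1, ‖(p + (t : ℂ) * s)⁻¹ - p⁻¹‖ ≤ 2 * ‖s‖ / δ ^ 2 := by
    intro t ht
    rw [uIoc_of_le zero_le_one] at ht
    have ht' : t ∈ Icc (0 : ℝ) 1 := ⟨ht.1.le, ht.2⟩
    have heq : (p + (t : ℂ) * s)⁻¹ - p⁻¹ = -((t : ℂ) * s) / (p * (p + (t : ℂ) * s)) := by
      field_simp [hpne, hne t ht']
      ring
    rw [heq, norm_div, norm_neg, norm_mul, norm_mul, Complex.norm_real, Real.norm_eq_abs, abs_of_nonneg ht'.1,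
      div_le_div_iff₀ (mul_pos (by linarith) (by linarith [hnorm t ht'])) (by positivity)]
    calc t * ‖s‖ * δ ^ 2 ≤ 1 * ‖s‖ * δ ^ 2 := by gcongr; exact ht'.2
      _ = 2 * ‖s‖ * (δ * (δ / 2)) := by ring
      _ ≤ 2 * ‖s‖ * (‖p‖ * ‖p + (t : ℂ) * s‖) := by gcongr; exact hnorm t ht'
  have hI := intervalIntegral.norm_integral_le_of_norm_le_const hbd
  simp only [sub_zero, abs_one, mul_one] at hI
  calc ‖s‖ * ‖∫ t in (0 : ℝ)..1, ((p + (t : ℂ) * s)⁻¹ - p⁻¹)‖ ≤ ‖s‖ * (2 * ‖s‖ / δ ^ 2) :=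
        mul_le_mul_of_nonneg_left hI (norm_nonneg _)
    _ = 2 * ‖s‖ ^ 2 / δ ^ 2 := by ring

/-- **Perturbation of the three arguments of `ell`**: for `p₁, p₂, p₃` with real parts `≥ δ` and
`|sᵢ| ≤ δ/2`,
`|[(5/8)log(p₁+s₁) + b log(p₂+s₂) + c log(p₃+s₃)] − [(5/8)log p₁ + b log p₂ + c log p₃]
  − [(5/8)s₁/p₁ + b s₂/p₂ + c s₃/p₃]| ≤ 2(5/8 + |b| + |c|)(|s₁|² + |s₂|² + |s₃|²)/δ²`.
[cite: LawlerSchrammWerner2003Restriction, proof of Lemma 8.9 (first-order dt-terms of dL)] -/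
theorem norm_ell_args_perturb_le (ρ : ℝ) {δ : ℝ} (hδ : 0 < δ) {p₁ p₂ p₃ s₁ s₂ s₃ : ℂ}
    (hp₁ : δ ≤ p₁.re) (hp₂ : δ ≤ p₂.re) (hp₃ : δ ≤ p₃.re)
    (hs₁ : ‖s₁‖ ≤ δ / 2) (hs₂ : ‖s₂‖ ≤ δ / 2) (hs₃ : ‖s₃‖ ≤ δ / 2) :
    ‖((5 / 8 : ℂ) * Complex.log (p₁ + s₁) + (expB ρ : ℂ) * Complex.log (p₂ + s₂) + (expC ρ : ℂ) * Complex.log (p₃ + s₃)) -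
        ((5 / 8 : ℂ) * Complex.log p₁ + (expB ρ : ℂ) * Complex.log p₂ + (expC ρ : ℂ) * Complex.log p₃) -
        ((5 / 8 : ℂ) * (s₁ / p₁) + (expB ρ : ℂ) * (s₂ / p₂) + (expC ρ : ℂ) * (s₃ / p₃))‖ ≤
      2 * (5 / 8 + |expB ρ| + |expC ρ|) * (‖s₁‖ ^ 2 + ‖s₂‖ ^ 2 + ‖s₃‖ ^ 2) / δ ^ 2 := by
  have e1 := norm_log_add_sub_log_sub_div_le hδ hp₁ hs₁
  have e2 := norm_log_add_sub_log_sub_div_le hδ hp₂ hs₂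
  have e3 := norm_log_add_sub_log_sub_div_le hδ hp₃ hs₃
  have hsplit : ((5 / 8 : ℂ) * Complex.log (p₁ + s₁) + (expB ρ : ℂ) * Complex.log (p₂ + s₂) + (expC ρ : ℂ) * Complex.log (p₃ + s₃)) -
        ((5 / 8 : ℂ) * Complex.log p₁ + (expB ρ : ℂ) * Complex.log p₂ + (expC ρ : ℂ) * Complex.log p₃) -
        ((5 / 8 : ℂ) * (s₁ / p₁) + (expB ρ : ℂ) * (s₂ / p₂) + (expC ρ : ℂ) * (s₃ / p₃)) =
      (5 / 8 : ℂ) * (Complex.log (p₁ + s₁) - Complex.log p₁ - s₁ / p₁) +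
        (expB ρ : ℂ) * (Complex.log (p₂ + s₂) - Complex.log p₂ - s₂ / p₂) +
        (expC ρ : ℂ) * (Complex.log (p₃ + s₃) - Complex.log p₃ - s₃ / p₃) := by ring
  rw [hsplit]
  have n58 : ‖(5 / 8 : ℂ)‖ = 5 / 8 := by norm_num
  have nb : ‖(expB ρ : ℂ)‖ = |expB ρ| := by rw [Complex.norm_real, Real.norm_eq_abs]
  have ncc : ‖(expC ρ : ℂ)‖ = |expC ρ| := by rw [Complex.norm_real, Real.norm_eq_abs]
  set Ssum : ℝ := ‖s₁‖ ^ 2 + ‖s₂‖ ^ 2 + ‖s₃‖ ^ 2 with hSsum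
  have h1 : 2 * ‖s₁‖ ^ 2 / δ ^ 2 ≤ 2 * Ssum / δ ^ 2 := by
    gcongr; rw [hSsum]; nlinarith [sq_nonneg ‖s₂‖, sq_nonneg ‖s₃‖]
  have h2 : 2 * ‖s₂‖ ^ 2 / δ ^ 2 ≤ 2 * Ssum / δ ^ 2 := by
    gcongr; rw [hSsum]; nlinarith [sq_nonneg ‖s₁‖, sq_nonneg ‖s₃‖]
  have h3 : 2 * ‖s₃‖ ^ 2 / δ ^ 2 ≤ 2 * Ssum / δ ^ 2 := by
    gcongr; rw [hSsum]; nlinarith [sq_nonneg ‖s₁‖, sq_nonneg ‖s₂‖]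
  calc _ ≤ ‖(5 / 8 : ℂ) * (Complex.log (p₁ + s₁) - Complex.log p₁ - s₁ / p₁)‖ +
        ‖(expB ρ : ℂ) * (Complex.log (p₂ + s₂) - Complex.log p₂ - s₂ / p₂)‖ +
        ‖(expC ρ : ℂ) * (Complex.log (p₃ + s₃) - Complex.log p₃ - s₃ / p₃)‖ := norm_add₃_le
    _ ≤ 5 / 8 * (2 * Ssum / δ ^ 2) + |expB ρ| * (2 * Ssum / δ ^ 2) + |expC ρ| * (2 * Ssum / δ ^ 2) := by
        rw [norm_mul, norm_mul, norm_mul, n58, nb, ncc]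
        gcongr
        · exact e1.trans h1
        · exact e2.trans h2
        · exact e3.trans h3
    _ = _ := by rw [hSsum]; ring

/-- **The first-order terms are `u·lam` up to the errors of the three expansions**: if
`sᵢ = 2u gᵢ + eᵢ` with `(g₁, g₂, g₃) = (D'(x), D'(y), DQ D x y)`, then
`(5/8)s₁/E'(x) + b s₂/E'(y) + c s₃/DQ E x y = u·lam E D ρ x y + [(5/8)e₁/E'(x) + b e₂/E'(y) + c e₃/DQ E x y]`
and the bracket is `≤ (5/8 + |b| + |c|) max|eᵢ|/δ`. [folklore] -/
theorem norm_first_order_sub_lam_le (hc : JetControl E δ η R) (ρ : ℝ) {x y : ℂ} (hx : x ∈ jetBox R η)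
    (hy : y ∈ jetBox R η) {u : ℝ} {e₁ e₂ e₃ : ℂ} {ε : ℝ} (he₁ : ‖e₁‖ ≤ ε) (he₂ : ‖e₂‖ ≤ ε) (he₃ : ‖e₃‖ ≤ ε) :
    ‖((5 / 8 : ℂ) * ((2 * u * deriv D x + e₁) / deriv E x) + (expB ρ : ℂ) * ((2 * u * deriv D y + e₂) / deriv E y) +
        (expC ρ : ℂ) * ((2 * u * DQ D x y + e₃) / DQ E x y)) - (u : ℂ) * lam E D ρ x y‖ ≤
      (5 / 8 + |expB ρ| + |expC ρ|) * ε / δ := by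
  have hδ := hc.δ_pos
  have hEx : δ ≤ ‖deriv E x‖ := (hc.le_re_deriv x hx).trans (re_le_norm _)
  have hEy : δ ≤ ‖deriv E y‖ := (hc.le_re_deriv y hy).trans (re_le_norm _)
  have hQ : δ ≤ ‖DQ E x y‖ := (le_re_DQ_and_norm_DQ_le hc hx hy).1.trans (re_le_norm _)
  have hε : 0 ≤ ε := (norm_nonneg _).trans he₁
  have hsplit : ((5 / 8 : ℂ) * ((2 * u * deriv D x + e₁) / deriv E x) + (expB ρ : ℂ) * ((2 * u * deriv D y + e₂) / deriv E y) +
        (expC ρ : ℂ) * ((2 * u * DQ D x y + e₃) / DQ E x y)) - (u : ℂ) * lam E D ρ x y =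
      (5 / 8 : ℂ) * (e₁ / deriv E x) + (expB ρ : ℂ) * (e₂ / deriv E y) + (expC ρ : ℂ) * (e₃ / DQ E x y) := by
    rw [lam]; ring
  rw [hsplit]
  have q1 : ‖e₁ / deriv E x‖ ≤ ε / δ := by rw [norm_div]; exact div_le_div₀ hε he₁ hδ hEx
  have q2 : ‖e₂ / deriv E y‖ ≤ ε / δ := by rw [norm_div]; exact div_le_div₀ hε he₂ hδ hEy
  have q3 : ‖e₃ / DQ E x y‖ ≤ ε / δ := by rw [norm_div]; exact div_le_div₀ hε he₃ hδ hQ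
  have n58 : ‖(5 / 8 : ℂ)‖ = 5 / 8 := by norm_num
  have nb : ‖(expB ρ : ℂ)‖ = |expB ρ| := by rw [Complex.norm_real, Real.norm_eq_abs]
  have ncc : ‖(expC ρ : ℂ)‖ = |expC ρ| := by rw [Complex.norm_real, Real.norm_eq_abs]
  calc _ ≤ ‖(5 / 8 : ℂ) * (e₁ / deriv E x)‖ + ‖(expB ρ : ℂ) * (e₂ / deriv E y)‖ + ‖(expC ρ : ℂ) * (e₃ / DQ E x y)‖ :=
        norm_add₃_le
    _ ≤ 5 / 8 * (ε / δ) + |expB ρ| * (ε / δ) + |expC ρ| * (ε / δ) := by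
        rw [norm_mul, norm_mul, norm_mul, n58, nb, ncc]; gcongr
    _ = _ := by ring

end SLEKappaRho

end Literature.Probability.RandomPlanarGeometry

end
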